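import Mathlib
import Literature.NumberTheory.Automorphic.HyperbolicLaplaceSpectrum
import HarnessLib

/-!
# The Bruggeman–Lewis–Zagier period cocycle of an invariant eigenfunction (line model)

Bruggeman, Lewis and Zagier, *Period functions for Maass wave forms and cohomology*,
Mem. AMS 237 no. 1118 (2015) [BruggemanLewisZagier2015] — page numbers below are the PDF pages of
the held authors' version `paper:doi-10-1090-memo-1118` (132 pp.) — attach to a `Γ`-invariant
`λ_s`-eigenfunction `u` of the hyperbolic Laplacian (`λ_s = s(1-s)`, `0 < Re s < 1`) the cocycle

  `r_γ(t) = ∫_{γ⁻¹ z₀}^{z₀} [u, R(t; ·)^s]`    (Introduction (6), p. 5; (5.5a), p. 29)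

with values in the analytic vectors `V_s^ω` of the principal series in its *line model*
(`(φ |_{2s} g)(t) = |ct+d|^{-2s} φ((at+b)/(ct+d))`, (2.1) p. 11), where
`R(t; z) = Im z / |z - t|²` is the Poisson kernel ((1.6), p. 10) and
`[u, v] = u_z v dz + u v_{z̄} dz̄` is the Green's form ((1.9), p. 11), closed when `u`, `v` are
eigenfunctions with the same eigenvalue. Their Theorems A–C identify spaces of Maass forms with
(parabolic, mixed parabolic) cohomology groups `H¹(Γ; V_s^ω)`, `H¹_par(Γ; V_s^ω, V_s^{ω*,∞})`, … .

## What is here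

1. **Definitions** (real, Mathlib-level), in the line model on functions `ℝ → ℂ`:
   `lineSlash s g φ` ((2.1); stated for all `g ∈ GL₂(ℝ)` by the same determinant-free formula, which
   for `det g = 1` is BLZ's action of `PSL₂(ℝ)`), `IsAnalyticVector s φ` (`φ ∈ V_s^ω`: real-analytic
   on `ℝ` and `|t|^{-2s} φ(-1/t)` extends analytically across `t = 0`, i.e. the expansion (2.2),
   p. 12, converges), `IsSemiAnalyticVector φ` (`V_s^{ω*}` of (2.22), p. 16, in the line model:
   real-analytic off a finite subset of `P¹(ℝ)`; as a set of functions this does not depend on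
   `s`), the Poisson kernel `hypPoissonKernel`, its power `hypPoissonKernelCpow s t z = R(t;z)^s`, the
   Wirtinger derivatives, the Green's form `greenForm`, its integral over a Euclidean segment
   `greenSegmentIntegral`, the period integral `greenPeriod s u a b t = ∫_a^b [u, R(t;·)^s]` and the
   cocycle `lewisZagierCocycle s z₀ u γ = greenPeriod s u (γ⁻¹ z₀) z₀` ((6)/(5.5a)), the space
   `E_s^Γ` of invariant eigenfunctions (`IsInvariantEigenfunction Γ s u`: `C²`, `Δu = λ_s u` in the
   tree's sign convention `hypLaplacian u + s(1-s) u = 0`, `Γ`-automorphic), and the condition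
   "all `Γ`-orbits in `∂ℍ = P¹(ℝ)` are infinite" (`HasInfiniteBoundaryOrbits`, via Mathlib's
   Möbius action of `GL (Fin 2) ℝ` on `OnePoint ℝ`).
2. **Named facts** (statements as printed, `def … : Prop`):
   * `BruggemanLewisZagier2015_cocycle_analytic` — "So `r_γ ∈ V_s^ω`" (p. 29, after (5.5a));
   * `BruggemanLewisZagier2015_prop_5_1` — **Proposition 5.1** (p. 30): for an infinite discrete `Γ` the map
     `r : E_s^Γ → H¹(Γ; V_s^ω)`, `u ↦ [γ ↦ r_γ]`, is injective (coboundaries are `φ|(γ - 1)`,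
     (5.4) p. 29), for every `s` with `0 < Re s < 1` — in particular at `s = 1/2`;
   * `BruggemanLewisZagier2015_singularities_invariants` — §13.1, p. 83: "Since all `Γ`-orbits in `∂ℍ` are
     infinite, we have `(W/V_s^ω)^Γ ⊂ S_s^Γ = {0}`" for the space of singularities
     `S_s = V_s^{ω*}/V_s^ω`: a semi-analytic vector all of whose coboundary values `φ|γ - φ` are
     analytic vectors is itself an analytic vector.
3. **Proved**: the consequence used by route `Langlands/RationalPeriodQuarter`
   (`eq_zero_of_lewisZagierCocycle_semiAnalytic_coboundary`): for `Γ ≤ GL₂(ℝ)` of determinant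
   one, discrete, with all boundary orbits infinite (e.g. any finite-index subgroup of the image of `SL₂(ℤ)`), an
   invariant eigenfunction whose cocycle `r^u` is a coboundary of a *semi-analytic* vector vanishes
   identically; plus API: `lineSlash_one_half`, `hypPoissonKernelCpow_one_half` (the `s = 1/2`
   shapes used by the route), `lineSlash_one/_neg/_mul` (right action off the poles),
   `lineSlash_congr_cofinite`, `analyticAt_lineSlash` and `IsSemiAnalyticVector.lineSlash`
   (`V_s^{ω*}` is stable under the action, p. 12/16), `isAnalyticVector_eSZero` (the basis vector
   `e_{s,0}(t) = (1+t²)^{-s}` of (2.17a) lies in `V_s^ω` — non-vacuity), the transformation law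
   **(2.25)** of the Poisson kernel `|ct+d|^{-2s} R(gt; g•z)^s = (det g)^{-s} R(t; z)^s`
   (`hypPoissonKernel_moebius`, `hypPoissonKernelCpow_glSmul`), `lewisZagierCocycle … 1 = 0`,
   `lewisZagierCocycle … (-γ) = lewisZagierCocycle … γ`, and a cheap criterion for infinite
   boundary orbits (`hasInfiniteBoundaryOrbits_of_unipotents`, covering `Γ₁(N)`).

## Conventions

* **Functions on `ℝ`, identities off finite sets.** Elements of `V_s^ω[F] ⊂ V_s^{ω*}` are sections
  over `P¹(ℝ) ∖ F` ((2.20)–(2.22)); in the line model we carry total functions `ℝ → ℂ` and read all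
  identities in `V_s^{ω*}` modulo finite sets (`∀ᶠ t in Filter.cofinite`). The formula (2.1) has a
  pole at `t = -d/c`; `lineSlash` returns the junk value `0 ^ (-2s) · φ(_) = 0` there, which the
  cofinite reading discards.
* **`Δ`.** BLZ use `Δ = -y²(∂²_x + ∂²_y)` and `Δu = s(1-s)u` (p. 4, (1.1)); the tree's
  `hypLaplacian = +y²(∂²_x + ∂²_y)` (Iwaniec's sign), so `E_s` is `hypLaplacian u + s(1-s) u = 0`.
  `C²` solutions are real-analytic by elliptic regularity (p. 9), so `IsC2` loses nothing.
* **`PSL₂(ℝ)` versus subgroups of `GL₂(ℝ)`.** Mathlib's `ℍ`, modular forms and cusps are built on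
  `GL (Fin 2) ℝ`; we state everything for `Γ : Subgroup (GL (Fin 2) ℝ)` with `Γ.HasDetOne`
  (BLZ: `Γ ⊂ PSL₂(ℝ)`). Both `lineSlash s (-g) = lineSlash s g` and `r_{-γ} = r_γ` hold, so a
  subgroup of `SL₂(ℝ)` and its image in `PSL₂(ℝ)` carry the same invariant eigenfunctions,
  cocycles and coboundaries; "infinite and discrete" is likewise insensitive to `±1`.

## What is NOT here

The isomorphism statements of Theorems A, B, C (surjectivity `H¹_par → Maass_s^0`, parabolic and
mixed parabolic cohomology, the modules `V_s^{ω*,∞}`, `V_s^∞`, `V_s^p`, `V_s^{ω*,exc}`), the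
transverse Poisson transform, stability of `V_s^ω` at the point `∞` under the action, and the
cocycle/closedness properties of `[u, R(t;·)^s]` (path independence, `r_{γδ} = r_γ|δ + r_δ`,
base-point change = coboundary), which are analysis to be proved, not vendored.

## References

* [BruggemanLewisZagier2015] R. Bruggeman, J. Lewis, D. Zagier, *Period functions for Maass wave
  forms and cohomology*, Mem. Amer. Math. Soc. 237 (2015), no. 1118, doi:10.1090/memo/1118:
  Introduction (6) p. 5, Theorem B p. 6; (1.6) p. 10; (1.9)–(1.10) p. 11; (2.1)–(2.2) pp. 11–12;
  (2.17a) p. 15; (2.22) p. 16; (5.4), (5.5a) p. 29; Proposition 5.1 pp. 30–31; §10.1 p. 65;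
  (13.2) and `S_s^Γ = {0}` p. 83.
-/

noncomputable section

namespace Literature.NumberTheory.Automorphic

open _root_.UpperHalfPlane _root_.Complex _root_.Filter _root_.Set _root_.MeasureTheory
open scoped MatrixGroups Topology ComplexConjugate

/-! ## 1. The line model of the principal series -/

section LineModel

/-- The **line-model action** of `g = (a b; c d)` at spectral parameter `s` on functions on the
boundary `ℝ ⊂ P¹(ℝ)`: `(φ |_{2s} g)(t) = |ct + d|^{-2s} φ((at + b)/(ct + d))` (BLZ (2.1)). It is a
right action. Stated by the same determinant-free formula for every `g ∈ GL₂(ℝ)` (for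
`det g = 1` this is the printed action of `PSL₂(ℝ)`; `lineSlash s (-g) = lineSlash s g`). At the
pole `t = -d/c` the value is the junk value `0` (`0 ^ (-2s) = 0`); identities in the line model are
read off finite sets. [cite: BruggemanLewisZagier2015, (2.1) p. 11] -/
def lineSlash (s : ℂ) (g : GL (Fin 2) ℝ) (φ : ℝ → ℂ) (t : ℝ) : ℂ :=
  ((|g 1 0 * t + g 1 1| : ℝ) : ℂ) ^ (-(2 * s)) * φ ((g 0 0 * t + g 0 1) / (g 1 0 * t + g 1 1))

/-- Unfolding of `lineSlash`. [cite: BruggemanLewisZagier2015, (2.1) p. 11] -/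
theorem lineSlash_apply (s : ℂ) (g : GL (Fin 2) ℝ) (φ : ℝ → ℂ) (t : ℝ) :
    lineSlash s g φ t =
      ((|g 1 0 * t + g 1 1| : ℝ) : ℂ) ^ (-(2 * s)) *
        φ ((g 0 0 * t + g 0 1) / (g 1 0 * t + g 1 1)) :=
  rfl

/-- At the unitary point `s = 1/2` the automorphy factor is `|ct + d|⁻¹` (the action used for
Maass forms of eigenvalue `1/4`). [cite: BruggemanLewisZagier2015, (2.1) p. 11] -/
theorem lineSlash_one_half (g : GL (Fin 2) ℝ) (φ : ℝ → ℂ) (t : ℝ) :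
    lineSlash (1 / 2) g φ t =
      ((|g 1 0 * t + g 1 1|⁻¹ : ℝ) : ℂ) * φ ((g 0 0 * t + g 0 1) / (g 1 0 * t + g 1 1)) := by
  rw [lineSlash_apply, show -(2 * (1 / 2 : ℂ)) = -1 by norm_num, Complex.cpow_neg_one,
    Complex.ofReal_inv]

/-- `-g` acts like `g` (the action factors through `PGL₂(ℝ)`-representatives up to sign).
[cite: BruggemanLewisZagier2015, (2.1) p. 11] -/
theorem lineSlash_neg (s : ℂ) (g : GL (Fin 2) ℝ) (φ : ℝ → ℂ) :
    lineSlash s (-g) φ = lineSlash s g φ := by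
  funext t
  simp only [lineSlash_apply]
  have e : ∀ i j : Fin 2, ((-g : GL (Fin 2) ℝ) i j : ℝ) = -(g i j : ℝ) := by
    intro i j; simp
  simp only [e]
  congr 2
  · rw [show -(g 1 0 : ℝ) * t + -(g 1 1 : ℝ) = -((g 1 0 : ℝ) * t + g 1 1) by ring, abs_neg]
  · rw [show -(g 0 0 : ℝ) * t + -(g 0 1 : ℝ) = -((g 0 0 : ℝ) * t + g 0 1) by ring,
      show -(g 1 0 : ℝ) * t + -(g 1 1 : ℝ) = -((g 1 0 : ℝ) * t + g 1 1) by ring, neg_div_neg_eq]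

/-- `lineSlash` only sees `φ` through its values, so two functions that agree off a finite set
have slashes that agree off a finite set (the Möbius map is injective off its pole).
[folklore] -/
theorem lineSlash_congr_cofinite (s : ℂ) (g : GL (Fin 2) ℝ) {φ φ' : ℝ → ℂ}
    (h : ∀ᶠ t in cofinite, φ t = φ' t) :
    ∀ᶠ t in cofinite, lineSlash s g φ t = lineSlash s g φ' t := by
  -- the exceptional set of `h`
  set E : Set ℝ := {x | φ x ≠ φ' x} with hE
  have hEfin : E.Finite := by
    have : {t | φ t = φ' t}ᶜ = E := by ext x; simp [hE]
    simpa [Filter.eventually_cofinite, this] using h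
  -- Möbius map and its pole
  set a : ℝ := g 0 0
  set b : ℝ := g 0 1
  set c : ℝ := g 1 0
  set d : ℝ := g 1 1
  have hdet : a * d - b * c ≠ 0 := by
    have h1 : ((g : GL (Fin 2) ℝ) : Matrix (Fin 2) (Fin 2) ℝ).det ≠ 0 :=
      (Matrix.GeneralLinearGroup.det_ne_zero g)
    rw [Matrix.det_fin_two] at h1
    exact h1
  let M : ℝ → ℝ := fun t => (a * t + b) / (c * t + d)
  -- the bad set is contained in the pole together with an injective preimage of `E`
  have hsub : {t | lineSlash s g φ t ≠ lineSlash s g φ' t} ⊆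
      {t | c * t + d = 0} ∪ {t | c * t + d ≠ 0 ∧ M t ∈ E} := by
    intro t ht
    by_cases hct : c * t + d = 0
    · exact Or.inl hct
    · refine Or.inr ⟨hct, ?_⟩
      simp only [mem_setOf_eq, hE]
      intro heq
      apply ht
      simp only [lineSlash_apply]
      change _ * φ (M t) = _ * φ' (M t)
      rw [heq]
  have hpole : {t : ℝ | c * t + d = 0}.Finite := by
    by_cases hc : c = 0
    · have hd : d ≠ 0 := by
        intro hd; apply hdet; rw [hc, hd]; ring
      have : {t : ℝ | c * t + d = 0} = ∅ := by
        ext t; simp [hc, hd]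
      rw [this]; exact finite_empty
    · have : {t : ℝ | c * t + d = 0} = {-d / c} := by
        ext t
        simp only [mem_setOf_eq, mem_singleton_iff]
        constructor
        · intro ht; field_simp; linarith
        · intro ht; rw [ht]; field_simp; ring
      rw [this]; exact finite_singleton _
  have hinj : InjOn M {t | c * t + d ≠ 0 ∧ M t ∈ E} := by
    intro t₁ h₁ t₂ h₂ h12
    have e1 : (a * t₁ + b) * (c * t₂ + d) = (a * t₂ + b) * (c * t₁ + d) := by
      have := h12
      simp only [M] at this
      rw [div_eq_div_iff h₁.1 h₂.1] at this
      linarith [this]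
    have e2 : (a * d - b * c) * (t₁ - t₂) = 0 := by linear_combination e1
    rcases mul_eq_zero.mp e2 with h0 | h0
    · exact absurd h0 hdet
    · linarith
  have hsecond : {t | c * t + d ≠ 0 ∧ M t ∈ E}.Finite :=
    Set.Finite.of_finite_image (hEfin.subset (by rintro _ ⟨t, ht, rfl⟩; exact ht.2)) hinj
  have hbad : {t | lineSlash s g φ t ≠ lineSlash s g φ' t}.Finite :=
    (hpole.union hsecond).subset hsub
  simpa [Filter.eventually_cofinite] using hbad

/-- Entries of a product in `GL (Fin 2) ℝ`. [folklore] -/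
theorem gl_mul_apply (g h : GL (Fin 2) ℝ) (i j : Fin 2) :
    ((g * h : GL (Fin 2) ℝ) i j : ℝ) = g i 0 * h 0 j + g i 1 * h 1 j := by
  rw [Units.val_mul, Matrix.mul_apply, Fin.sum_univ_two]

/-- **Right action law** of the line model off the pole of `h`: `φ |(g h) = (φ | g) | h` at every
`t` with `c_h t + d_h ≠ 0` (at a pole of `g ∘ h` that is not a pole of `h` both sides are the junk
value `0`). [cite: BruggemanLewisZagier2015, (2.1) p. 11] -/
theorem lineSlash_mul (s : ℂ) (g h : GL (Fin 2) ℝ) (φ : ℝ → ℂ) {t : ℝ}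
    (hh : h 1 0 * t + h 1 1 ≠ 0) :
    lineSlash s (g * h) φ t = lineSlash s h (lineSlash s g φ) t := by
  set D : ℝ := h 1 0 * t + h 1 1 with hD
  set x : ℝ := (h 0 0 * t + h 0 1) / D with hx
  have num : (g * h : GL (Fin 2) ℝ) 0 0 * t + (g * h : GL (Fin 2) ℝ) 0 1 =
      D * (g 0 0 * x + g 0 1) := by
    rw [gl_mul_apply, gl_mul_apply, hx]
    field_simp
    ring
  have den : (g * h : GL (Fin 2) ℝ) 1 0 * t + (g * h : GL (Fin 2) ℝ) 1 1 =
      D * (g 1 0 * x + g 1 1) := by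
    rw [gl_mul_apply, gl_mul_apply, hx]
    field_simp
    ring
  rw [lineSlash_apply, num, den, lineSlash_apply, lineSlash_apply]
  rw [← hD, ← hx, abs_mul, Complex.ofReal_mul,
    Complex.mul_cpow_ofReal_nonneg (abs_nonneg _) (abs_nonneg _),
    mul_div_mul_left _ _ hh]
  ring

/-- Real-analyticity of `t ↦ (p t)^w` (`p` real-analytic and positive, `w ∈ ℂ`, principal
branch). [folklore] -/
theorem analyticAt_ofReal_cpow_const {p : ℝ → ℝ} {t₀ : ℝ} (hp : AnalyticAt ℝ p t₀)
    (hpos : 0 < p t₀) (w : ℂ) :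
    AnalyticAt ℝ (fun t => ((p t : ℝ) : ℂ) ^ w) t₀ := by
  have h1 : AnalyticAt ℝ (fun t => ((p t : ℝ) : ℂ)) t₀ :=
    (Complex.ofRealCLM.analyticAt _).comp hp
  have h2 : AnalyticAt ℂ (fun z : ℂ => z ^ w) ((p t₀ : ℝ) : ℂ) :=
    AnalyticAt.cpow analyticAt_id analyticAt_const (by simp [Complex.mem_slitPlane_iff, hpos])
  have h3 : AnalyticAt ℝ ((fun z : ℂ => z ^ w) ∘ fun t => ((p t : ℝ) : ℂ)) t₀ :=
    AnalyticAt.comp (g := fun z : ℂ => z ^ w) (f := fun t => ((p t : ℝ) : ℂ)) (x := t₀)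
      (h2.restrictScalars (𝕜 := ℝ)) h1
  exact h3

/-- The identity acts trivially. [cite: BruggemanLewisZagier2015, (2.1) p. 11] -/
@[simp] theorem lineSlash_one (s : ℂ) (φ : ℝ → ℂ) : lineSlash s 1 φ = φ := by
  funext t
  simp [lineSlash_apply]

/-- The Möbius map `t ↦ (at + b)/(ct + d)` of `g` is real-analytic off the pole. [folklore] -/
theorem analyticAt_moebius (g : GL (Fin 2) ℝ) {t : ℝ} (ht : g 1 0 * t + g 1 1 ≠ 0) :
    AnalyticAt ℝ (fun x : ℝ => (g 0 0 * x + g 0 1) / (g 1 0 * x + g 1 1)) t :=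
  ((analyticAt_const.mul analyticAt_id).add analyticAt_const).div
    ((analyticAt_const.mul analyticAt_id).add analyticAt_const) ht

/-- The automorphy factor `t ↦ |ct + d|^{-2s}` is real-analytic off the pole. [folklore] -/
theorem analyticAt_automorphyFactor (s : ℂ) (g : GL (Fin 2) ℝ) {t : ℝ}
    (ht : g 1 0 * t + g 1 1 ≠ 0) :
    AnalyticAt ℝ (fun x : ℝ => ((|g 1 0 * x + g 1 1| : ℝ) : ℂ) ^ (-(2 * s))) t := by
  have hlin : AnalyticAt ℝ (fun x : ℝ => g 1 0 * x + g 1 1) t :=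
    (analyticAt_const.mul analyticAt_id).add analyticAt_const
  rcases lt_or_gt_of_ne ht with hneg | hpos
  · -- near `t` the factor is `(-(cx + d))^{-2s}`
    have key : AnalyticAt ℝ (fun x : ℝ => ((-(g 1 0 * x + g 1 1) : ℝ) : ℂ) ^ (-(2 * s))) t :=
      analyticAt_ofReal_cpow_const (p := fun x : ℝ => -(g 1 0 * x + g 1 1)) hlin.neg
        (by show (0 : ℝ) < -(g 1 0 * t + g 1 1); linarith) _
    refine key.congr ?_
    have hopen : ∀ᶠ x in 𝓝 t, g 1 0 * x + g 1 1 < 0 :=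
      hlin.continuousAt.eventually_lt continuousAt_const hneg
    filter_upwards [hopen] with x hx
    simp [abs_of_neg hx]
  · have key : AnalyticAt ℝ (fun x : ℝ => (((g 1 0 * x + g 1 1) : ℝ) : ℂ) ^ (-(2 * s))) t :=
      analyticAt_ofReal_cpow_const (p := fun x : ℝ => g 1 0 * x + g 1 1) hlin
        (by show (0 : ℝ) < g 1 0 * t + g 1 1; exact hpos) _
    refine key.congr ?_
    have hopen : ∀ᶠ x in 𝓝 t, 0 < g 1 0 * x + g 1 1 :=
      continuousAt_const.eventually_lt hlin.continuousAt hpos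
    filter_upwards [hopen] with x hx
    simp [abs_of_pos hx]

/-- `φ | g` is real-analytic at every non-pole `t` with `φ` real-analytic at `g t` ("it requires
some work to check that the spaces `V_s^ω, V_s^∞, …` are preserved", p. 12 — the finite part).
[cite: BruggemanLewisZagier2015, (2.1) p. 12] -/
theorem analyticAt_lineSlash (s : ℂ) (g : GL (Fin 2) ℝ) {φ : ℝ → ℂ} {t : ℝ}
    (ht : g 1 0 * t + g 1 1 ≠ 0)
    (hφ : AnalyticAt ℝ φ ((g 0 0 * t + g 0 1) / (g 1 0 * t + g 1 1))) :
    AnalyticAt ℝ (lineSlash s g φ) t := by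
  have h2 : AnalyticAt ℝ (fun x => φ ((g 0 0 * x + g 0 1) / (g 1 0 * x + g 1 1))) t :=
    AnalyticAt.comp (g := φ) (f := fun x : ℝ => (g 0 0 * x + g 0 1) / (g 1 0 * x + g 1 1))
      (x := t) hφ (analyticAt_moebius g ht)
  exact (analyticAt_automorphyFactor s g ht).mul h2

/-- **Analytic vectors** `V_s^ω` of the principal series in the line model: `φ` is real-analytic
on `ℝ` and real-analytic "at `∞`", i.e. `t ↦ |t|^{-2s} φ(-1/t)` (the slash of `φ` by
`S = (0 -1; 1 0)`) agrees on `t ≠ 0` with a function analytic at `0`; equivalently the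
expansion `φ(t) ~ |t|^{-2s} Σ cₙ t^{-n}` of (2.2) converges for `|t|` large.
[cite: BruggemanLewisZagier2015, (2.2) p. 12] -/
def IsAnalyticVector (s : ℂ) (φ : ℝ → ℂ) : Prop :=
  AnalyticOnNhd ℝ φ Set.univ ∧
    ∃ ψ : ℝ → ℂ, AnalyticAt ℝ ψ 0 ∧
      ∀ t : ℝ, t ≠ 0 → ψ t = ((|t| : ℝ) : ℂ) ^ (-(2 * s)) * φ (-1 / t)

/-- **Semi-analytic vectors** `V_s^{ω*} = lim_F V_s^ω(P¹(ℝ) ∖ F)` ((2.22)) in the line model: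
`φ` is real-analytic on the complement of a finite subset of `ℝ` (the point `∞` may always be
taken to be one of the finitely many singularities, so no condition at `∞` remains). Elements of
`V_s^{ω*}` are sections over `P¹(ℝ) ∖ F`, so total functions are compared modulo finite sets;
as a set of functions `V_s^{ω*}` does not depend on `s` (only the action `lineSlash s` does).
[cite: BruggemanLewisZagier2015, (2.22) p. 16] -/
def IsSemiAnalyticVector (φ : ℝ → ℂ) : Prop :=
  ∃ F : Finset ℝ, AnalyticOnNhd ℝ φ (↑F : Set ℝ)ᶜ

/-- `V_s^ω ⊂ V_s^{ω*}`. [cite: BruggemanLewisZagier2015, (2.22) p. 16] -/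
theorem IsAnalyticVector.isSemiAnalyticVector {s : ℂ} {φ : ℝ → ℂ} (h : IsAnalyticVector s φ) :
    IsSemiAnalyticVector φ :=
  ⟨∅, fun t _ => h.1 t (mem_univ t)⟩

/-- The zero function is an analytic vector. [folklore] -/
theorem isAnalyticVector_zero (s : ℂ) : IsAnalyticVector s 0 :=
  ⟨fun _ _ => analyticAt_const, ⟨0, analyticAt_const, fun t _ => by simp⟩⟩

/-- A semi-analytic vector modified on a finite set is semi-analytic. [folklore] -/
theorem IsSemiAnalyticVector.congr_cofinite {φ φ' : ℝ → ℂ} (h : IsSemiAnalyticVector φ)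
    (he : ∀ᶠ t in cofinite, φ t = φ' t) : IsSemiAnalyticVector φ' := by
  obtain ⟨F, hF⟩ := h
  have hfin : {t | ¬ φ t = φ' t}.Finite := Filter.eventually_cofinite.mp he
  refine ⟨F ∪ hfin.toFinset, fun t ht => ?_⟩
  simp only [Finset.coe_union, Finite.coe_toFinset, compl_union, mem_inter_iff, mem_compl_iff,
    Finset.mem_coe, mem_setOf_eq, not_not] at ht
  have hopen : IsOpen ((↑F : Set ℝ)ᶜ ∩ {t | ¬ φ t = φ' t}ᶜ) :=
    (F.finite_toSet.isClosed.isOpen_compl).inter hfin.isClosed.isOpen_compl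
  have hmem : t ∈ (↑F : Set ℝ)ᶜ ∩ {t | ¬ φ t = φ' t}ᶜ := ⟨ht.1, by simpa using ht.2⟩
  refine (hF t ht.1).congr ?_
  filter_upwards [hopen.mem_nhds hmem] with x hx
  simpa using hx.2

/-- **`V_s^{ω*}` is stable under the action** (line model): if `φ` is real-analytic off a finite
set then so is `φ |_{2s} g` (off the pole of `g` and the `g`-preimage of the singular set).
[cite: BruggemanLewisZagier2015, (2.22) p. 16] -/
theorem IsSemiAnalyticVector.lineSlash (s : ℂ) (g : GL (Fin 2) ℝ) {φ : ℝ → ℂ}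
    (h : IsSemiAnalyticVector φ) : IsSemiAnalyticVector (lineSlash s g φ) := by
  classical
  obtain ⟨F, hF⟩ := h
  -- bad set: the pole of `g` and the non-pole points mapped into `F`; both finite
  set c : ℝ := g 1 0
  set d : ℝ := g 1 1
  have hdet : (g 0 0 : ℝ) * d - g 0 1 * c ≠ 0 := by
    have h1 : ((g : GL (Fin 2) ℝ) : Matrix (Fin 2) (Fin 2) ℝ).det ≠ 0 :=
      Matrix.GeneralLinearGroup.det_ne_zero g
    rw [Matrix.det_fin_two] at h1
    exact h1
  let M : ℝ → ℝ := fun t => (g 0 0 * t + g 0 1) / (c * t + d)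
  have hpole : {t : ℝ | c * t + d = 0}.Finite := by
    by_cases hc : c = 0
    · have hd : d ≠ 0 := by
        intro hd; apply hdet; rw [hc, hd]; ring
      have : {t : ℝ | c * t + d = 0} = ∅ := by
        ext t; simp [hc, hd]
      rw [this]; exact finite_empty
    · have : {t : ℝ | c * t + d = 0} = {-d / c} := by
        ext t
        simp only [mem_setOf_eq, mem_singleton_iff]
        constructor
        · intro ht; field_simp; linarith
        · intro ht; rw [ht]; field_simp; ring
      rw [this]; exact finite_singleton _
  have hinj : InjOn M {t | c * t + d ≠ 0 ∧ M t ∈ (↑F : Set ℝ)} := by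
    intro t₁ h₁ t₂ h₂ h12
    have e1 : (g 0 0 * t₁ + g 0 1) * (c * t₂ + d) = (g 0 0 * t₂ + g 0 1) * (c * t₁ + d) := by
      have := h12
      simp only [M] at this
      rw [div_eq_div_iff h₁.1 h₂.1] at this
      linarith [this]
    have e2 : ((g 0 0 : ℝ) * d - g 0 1 * c) * (t₁ - t₂) = 0 := by linear_combination e1
    rcases mul_eq_zero.mp e2 with h0 | h0
    · exact absurd h0 hdet
    · linarith
  have hpre : {t | c * t + d ≠ 0 ∧ M t ∈ (↑F : Set ℝ)}.Finite :=
    Set.Finite.of_finite_image (F.finite_toSet.subset (by rintro _ ⟨t, ht, rfl⟩; exact ht.2)) hinj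
  refine ⟨(hpole.union hpre).toFinset, fun t ht => ?_⟩
  simp only [Finite.coe_toFinset, mem_compl_iff, mem_union, mem_setOf_eq, not_or, not_and] at ht
  have hct : c * t + d ≠ 0 := ht.1
  exact analyticAt_lineSlash s g hct (hF _ (ht.2 hct))

/-- The spherical vector `e_{s,0}(t) = (t² + 1)^{-s}` of (2.17a). [cite: BruggemanLewisZagier2015, (2.17a) p. 15] -/
def eSZero (s : ℂ) (t : ℝ) : ℂ :=
  ((t ^ 2 + 1 : ℝ) : ℂ) ^ (-s)

/-- **Non-vacuity of `IsAnalyticVector`**: `e_{s,0} ∈ V_s^ω` — at infinity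
`|t|^{-2s} e_{s,0}(-1/t) = (1 + t²)^{-s}` is analytic at `0`.
[cite: BruggemanLewisZagier2015, (2.17a) p. 15] -/
theorem isAnalyticVector_eSZero (s : ℂ) : IsAnalyticVector s (eSZero s) := by
  have han : ∀ t₀ : ℝ, AnalyticAt ℝ (eSZero s) t₀ := fun t₀ => by
    have hp : AnalyticAt ℝ (fun t : ℝ => t ^ 2 + 1) t₀ :=
      (analyticAt_id.pow 2).add analyticAt_const
    exact analyticAt_ofReal_cpow_const hp (by show (0 : ℝ) < t₀ ^ 2 + 1; positivity) (-s)
  refine ⟨fun t _ => han t, ⟨eSZero s, han 0, fun t ht => ?_⟩⟩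
  -- `|t|^{-2s} ((-1/t)² + 1)^{-s} = (t²)^{-s} (t⁻² + 1)^{-s} = (t² + 1)^{-s}`
  have habs : ((|t| : ℝ) : ℂ) ^ (-(2 * s)) = ((t ^ 2 : ℝ) : ℂ) ^ (-s) := by
    have hne : ((|t| : ℝ) : ℂ) ≠ 0 := by exact_mod_cast (abs_pos.mpr ht).ne'
    rw [show (t ^ 2 : ℝ) = |t| * |t| by rw [← sq_abs]; ring, Complex.ofReal_mul,
      Complex.mul_cpow_ofReal_nonneg (abs_nonneg t) (abs_nonneg t),
      ← Complex.cpow_add _ _ hne]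
    congr 1
    ring
  have htc : (t : ℂ) ≠ 0 := by exact_mod_cast ht
  simp only [eSZero]
  rw [habs, ← Complex.mul_cpow_ofReal_nonneg (sq_nonneg t) (by positivity)]
  congr 1
  push_cast
  field_simp
  ring

end LineModel

/-! ## 2. Poisson kernel, Green's form and the period cocycle -/

section Cocycle

/-- The **Poisson kernel** `R(t; z) = Im(1/(t - z)) = y / |t - z|²` of BLZ (1.6), as a real
function of `z ∈ ℂ` (meaningful for `Im z > 0`; `R(t; t) = 0/0 = 0` is a junk value).
[cite: BruggemanLewisZagier2015, (1.6) p. 10] -/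
def hypPoissonKernel (t : ℝ) (z : ℂ) : ℝ :=
  z.im / ‖z - t‖ ^ 2

/-- `R(t; z)^s = (y / |t - z|²)^s` ((1.6)), principal branch of the complex power of the real
base `R(t; z)` (positive on `ℍ`); `R(t; ·)^s ∈ E_s` is a `λ_s`-eigenfunction.
[cite: BruggemanLewisZagier2015, (1.6) p. 10] -/
def hypPoissonKernelCpow (s : ℂ) (t : ℝ) (z : ℂ) : ℂ :=
  ((hypPoissonKernel t z : ℝ) : ℂ) ^ s

/-- At `s = 1/2`: `R(t; z)^{1/2} = √y / |z - t|` on the closed upper half-plane.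
[cite: BruggemanLewisZagier2015, (1.6) p. 10] -/
theorem hypPoissonKernelCpow_one_half {t : ℝ} {z : ℂ} (hz : 0 ≤ z.im) :
    hypPoissonKernelCpow (1 / 2) t z = ((Real.sqrt z.im / ‖z - t‖ : ℝ) : ℂ) := by
  unfold hypPoissonKernelCpow hypPoissonKernel
  have h0 : 0 ≤ z.im / ‖z - (t : ℂ)‖ ^ 2 := div_nonneg hz (sq_nonneg _)
  rw [show (1 / 2 : ℂ) = ((1 / 2 : ℝ) : ℂ) by norm_num, ← Complex.ofReal_cpow h0,
    ← Real.sqrt_eq_rpow, Real.sqrt_div' _ (sq_nonneg _), Real.sqrt_sq (norm_nonneg _)]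

/-- `R(t; z) > 0` on the upper half-plane. [cite: BruggemanLewisZagier2015, (1.6) p. 10] -/
theorem hypPoissonKernel_pos (t : ℝ) {z : ℂ} (hz : 0 < z.im) : 0 < hypPoissonKernel t z := by
  unfold hypPoissonKernel
  have hne : z - (t : ℂ) ≠ 0 := by
    intro h
    have := congrArg Complex.im h
    simp at this
    linarith
  exact div_pos hz (by positivity)

/-- **Transformation of the Poisson kernel under a Möbius map** of positive determinant
`δ = ad - bc`: `R(g t; g Z) = (ct + d)² δ⁻¹ R(t; Z)` (`Im Z > 0`, `ct + d ≠ 0`); the real identity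
behind (2.25). [cite: BruggemanLewisZagier2015, (2.25) p. 16] -/
theorem hypPoissonKernel_moebius {a b c d : ℝ} (hdet : 0 < a * d - b * c) {Z : ℂ} (hZ : 0 < Z.im)
    {t : ℝ} (ht : c * t + d ≠ 0) :
    hypPoissonKernel ((a * t + b) / (c * t + d)) ((a * Z + b) / (c * Z + d)) =
      (c * t + d) ^ 2 / (a * d - b * c) * hypPoissonKernel t Z := by
  have hD : (c : ℂ) * Z + d ≠ 0 := by
    intro h
    have him := congrArg Complex.im h
    have hre := congrArg Complex.re h
    simp at him hre
    rcases him with hc | hy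
    · subst hc
      simp at hre
      subst hre
      simp at hdet
    · linarith
  have hδ : (a * d - b * c) ≠ 0 := hdet.ne'
  have htC : ((c * t + d : ℝ) : ℂ) ≠ 0 := by exact_mod_cast ht
  have hZt : Z - (t : ℂ) ≠ 0 := by
    intro h
    have := congrArg Complex.im h
    simp at this
    linarith
  -- the difference of the two image points
  have htC' : (c : ℂ) * t + d ≠ 0 := by
    have : ((c * t + d : ℝ) : ℂ) = (c : ℂ) * t + d := by push_cast; ring
    rwa [this] at htC
  have hsub : (a * Z + b) / (c * Z + d) - ((((a * t + b) / (c * t + d) : ℝ)) : ℂ) =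
      ((a * d - b * c : ℝ) : ℂ) * (Z - t) / ((c * Z + d) * ((c * t + d : ℝ) : ℂ)) := by
    have e : ((((a * t + b) / (c * t + d) : ℝ)) : ℂ) = ((a : ℂ) * t + b) / ((c : ℂ) * t + d) := by
      push_cast; ring
    rw [e, div_sub_div _ _ hD htC']
    push_cast
    congr 1
    ring
  -- the imaginary part of the image point
  have him : ((a * Z + b) / (c * Z + d)).im =
      (a * d - b * c) * Z.im / Complex.normSq (c * Z + d) := by
    have hn : Complex.normSq ((c : ℂ) * Z + d) ≠ 0 := (Complex.normSq_pos.mpr hD).ne'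
    rw [Complex.div_im]
    field_simp
    simp only [Complex.add_re, Complex.mul_re, Complex.ofReal_re, Complex.ofReal_im, zero_mul,
      sub_zero, Complex.add_im, Complex.mul_im, add_zero]
    ring
  unfold hypPoissonKernel
  rw [hsub, him, norm_div, norm_mul, norm_mul, Complex.norm_real, Complex.norm_real,
    Real.norm_eq_abs, Real.norm_eq_abs, Complex.normSq_eq_norm_sq]
  have hDn : ‖(c : ℂ) * Z + d‖ ≠ 0 := norm_ne_zero_iff.mpr hD
  have hZtn : ‖Z - (t : ℂ)‖ ≠ 0 := norm_ne_zero_iff.mpr hZt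
  have habsδ : |a * d - b * c| = a * d - b * c := abs_of_pos hdet
  have habsj : |c * t + d| ^ 2 = (c * t + d) ^ 2 := sq_abs _
  rw [div_pow, mul_pow, mul_pow, habsδ, habsj]
  field_simp

/-- The same law for `g ∈ GL₂(ℝ)⁺` acting on `ℍ` (Mathlib's action):
`R(g t; g • z) = (ct + d)² (det g)⁻¹ R(t; z)`. [cite: BruggemanLewisZagier2015, (2.25) p. 16] -/
theorem hypPoissonKernel_glSmul {g : GL (Fin 2) ℝ} (hg : 0 < g.det.val) (z : ℍ) {t : ℝ}
    (ht : g 1 0 * t + g 1 1 ≠ 0) :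
    hypPoissonKernel ((g 0 0 * t + g 0 1) / (g 1 0 * t + g 1 1)) ((g • z : ℍ) : ℂ) =
      (g 1 0 * t + g 1 1) ^ 2 / g.det.val * hypPoissonKernel t z := by
  have hdet' : 0 < (g 0 0 : ℝ) * g 1 1 - g 0 1 * g 1 0 := by
    have := hg
    rwa [Matrix.GeneralLinearGroup.val_det_apply, Matrix.det_fin_two] at this
  have h := hypPoissonKernel_moebius hdet' z.im_pos ht
  rw [UpperHalfPlane.coe_smul_of_det_pos hg, Matrix.GeneralLinearGroup.val_det_apply,
    Matrix.det_fin_two]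
  simpa [UpperHalfPlane.num, UpperHalfPlane.denom] using h

/-- **BLZ (2.25)**: `R(·; g z)^s |_{2s} g = (det g)^{-s} R(·; z)^s`, i.e.
`|ct + d|^{-2s} R(g t; g • z)^s = (det g)^{-s} R(t; z)^s` for `g ∈ GL₂(ℝ)⁺`, `z ∈ ℍ`, `t` off the
pole; for `det g = 1` this is the printed `R(·; gz)|_{2s} g = R(·; z)^s`, the `G`-equivariance of
the Poisson transform. [cite: BruggemanLewisZagier2015, (2.25) p. 16] -/
theorem hypPoissonKernelCpow_glSmul (s : ℂ) {g : GL (Fin 2) ℝ} (hg : 0 < g.det.val) (z : ℍ)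
    {t : ℝ} (ht : g 1 0 * t + g 1 1 ≠ 0) :
    ((|g 1 0 * t + g 1 1| : ℝ) : ℂ) ^ (-(2 * s)) *
        hypPoissonKernelCpow s ((g 0 0 * t + g 0 1) / (g 1 0 * t + g 1 1)) ((g • z : ℍ) : ℂ) =
      ((g.det.val : ℝ) : ℂ) ^ (-s) * hypPoissonKernelCpow s t z := by
  unfold hypPoissonKernelCpow
  rw [hypPoissonKernel_glSmul hg z ht]
  set j : ℝ := g 1 0 * t + g 1 1 with hj
  set δ : ℝ := g.det.val with hδ
  set R : ℝ := hypPoissonKernel t z with hR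
  have hR0 : 0 ≤ R := (hypPoissonKernel_pos t z.im_pos).le
  have hjabs : 0 < |j| := abs_pos.mpr ht
  have hjC : ((|j| : ℝ) : ℂ) ≠ 0 := by exact_mod_cast hjabs.ne'
  -- split the real base `j² / δ * R = (|j| * |j|) * (δ⁻¹ * R)` into nonnegative factors
  have e1 : (j ^ 2 / δ * R : ℝ) = (|j| * |j|) * (δ⁻¹ * R) := by
    rw [← sq_abs, sq]; ring
  rw [e1, Complex.ofReal_mul, Complex.mul_cpow_ofReal_nonneg (by positivity) (by positivity),
    Complex.ofReal_mul, Complex.mul_cpow_ofReal_nonneg hjabs.le hjabs.le,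
    Complex.ofReal_mul, Complex.mul_cpow_ofReal_nonneg (by positivity) hR0,
    ← Complex.cpow_add _ _ hjC]
  -- `|j|^{-2s} |j|^{2s} = 1` and `(δ⁻¹)^s = δ^{-s}`
  have e2 : ((|j| : ℝ) : ℂ) ^ (-(2 * s)) * ((|j| : ℝ) : ℂ) ^ (s + s) = 1 := by
    rw [← Complex.cpow_add _ _ hjC, show -(2 * s) + (s + s) = 0 by ring, Complex.cpow_zero]
  have e3 : (((δ⁻¹ : ℝ)) : ℂ) ^ s = ((δ : ℝ) : ℂ) ^ (-s) := by
    rw [Complex.ofReal_inv, Complex.inv_cpow _ _ ?_, Complex.cpow_neg]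
    rw [Complex.arg_ofReal_of_nonneg hg.le]
    exact Real.pi_pos.ne
  calc ((|j| : ℝ) : ℂ) ^ (-(2 * s)) *
        (((|j| : ℝ) : ℂ) ^ (s + s) * ((((δ⁻¹ : ℝ)) : ℂ) ^ s * ((R : ℝ) : ℂ) ^ s))
      = (((|j| : ℝ) : ℂ) ^ (-(2 * s)) * ((|j| : ℝ) : ℂ) ^ (s + s)) *
          ((((δ⁻¹ : ℝ)) : ℂ) ^ s * ((R : ℝ) : ℂ) ^ s) := by ring
    _ = ((δ : ℝ) : ℂ) ^ (-s) * ((R : ℝ) : ℂ) ^ s := by rw [e2, one_mul, e3]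

/-- The Wirtinger derivative `∂/∂z = ½ (∂_x - i ∂_y)` of `U : ℂ → ℂ` (real Fréchet derivative;
junk value `0` where `U` is not real-differentiable). [folklore] -/
def wirtingerDz (U : ℂ → ℂ) (w : ℂ) : ℂ :=
  (fderiv ℝ U w 1 - Complex.I * fderiv ℝ U w Complex.I) / 2

/-- The Wirtinger derivative `∂/∂z̄ = ½ (∂_x + i ∂_y)` of `U : ℂ → ℂ`. [folklore] -/
def wirtingerDzbar (U : ℂ → ℂ) (w : ℂ) : ℂ :=
  (fderiv ℝ U w 1 + Complex.I * fderiv ℝ U w Complex.I) / 2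

/-- The **Green's form** `[U, V] = U_z V dz + U V_{z̄} dz̄` of BLZ (1.9) at the point `w`,
evaluated on the tangent vector `h` (`dz(h) = h`, `dz̄(h) = h̄`). It is a closed `1`-form when
`U`, `V` are `λ_s`-eigenfunctions of `Δ` with the same `s` ((1.10c)).
[cite: BruggemanLewisZagier2015, (1.9) p. 11] -/
def greenForm (U V : ℂ → ℂ) (w h : ℂ) : ℂ :=
  wirtingerDz U w * V w * h + U w * wirtingerDzbar V w * conj h

/-- The Green's form vanishes on the zero tangent vector. [folklore] -/
@[simp] theorem greenForm_zero_right (U V : ℂ → ℂ) (w : ℂ) : greenForm U V w 0 = 0 := by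
  simp [greenForm]

/-- `∫_{[a, b]} [U, V]`: the integral of the Green's form along the Euclidean segment from `a`
to `b`, parametrised by `τ ↦ (1 - τ) a + τ b`, `τ ∈ [0, 1]` (velocity `b - a`).
[cite: BruggemanLewisZagier2015, (1.9) p. 11] -/
def greenSegmentIntegral (U V : ℂ → ℂ) (a b : ℂ) : ℂ :=
  ∫ τ in (0 : ℝ)..1, greenForm U V ((1 - (τ : ℂ)) * a + (τ : ℂ) * b) (b - a)

/-- The segment integral over a degenerate segment vanishes. [folklore] -/
@[simp] theorem greenSegmentIntegral_self (U V : ℂ → ℂ) (a : ℂ) :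
    greenSegmentIntegral U V a a = 0 := by
  simp [greenSegmentIntegral]

/-- The **period integral** `∫_a^b [u, R(t; ·)^s]` of an eigenfunction `u : ℍ → ℂ` against the
Poisson kernel, along the Euclidean segment from `a` to `b` in `ℍ` (`u` is extended to `ℂ` by
Mathlib's `UpperHalfPlane.ofComplex`, which agrees with `u` on the open set `ℍ` containing the
segment). For `u ∈ E_s` the form is closed, so any path in `ℍ` gives the same value.
[cite: BruggemanLewisZagier2015, (6) p. 5] -/
def greenPeriod (s : ℂ) (u : ℍ → ℂ) (a b : ℍ) (t : ℝ) : ℂ :=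
  greenSegmentIntegral (u ∘ ofComplex) (hypPoissonKernelCpow s t) (a : ℂ) (b : ℂ)

/-- The **Bruggeman–Lewis–Zagier period cocycle** of `u` with base point `z₀ ∈ ℍ`:
`r_γ(t) = ∫_{γ⁻¹ z₀}^{z₀} [u, R(t; ·)^s]` (Introduction (6); (5.5a)), an inhomogeneous
`1`-cocycle `γ ↦ r_γ` on any `Γ ∋ γ` leaving `u ∈ E_s` invariant, with values in `V_s^ω` (line
model, right action `lineSlash s`): `r_{γδ} = r_γ|δ + r_δ` ((5.4)); changing `z₀` changes it by a
coboundary. [cite: BruggemanLewisZagier2015, (5.5a) p. 29] -/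
def lewisZagierCocycle (s : ℂ) (z₀ : ℍ) (u : ℍ → ℂ) (γ : GL (Fin 2) ℝ) (t : ℝ) : ℂ :=
  greenPeriod s u (γ⁻¹ • z₀) z₀ t

/-- Unfolding of `lewisZagierCocycle`. [cite: BruggemanLewisZagier2015, (5.5a) p. 29] -/
theorem lewisZagierCocycle_apply (s : ℂ) (z₀ : ℍ) (u : ℍ → ℂ) (γ : GL (Fin 2) ℝ) (t : ℝ) :
    lewisZagierCocycle s z₀ u γ t =
      ∫ τ in (0 : ℝ)..1, greenForm (u ∘ ofComplex) (hypPoissonKernelCpow s t)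
        ((1 - (τ : ℂ)) * ((γ⁻¹ • z₀ : ℍ) : ℂ) + (τ : ℂ) * (z₀ : ℂ))
        ((z₀ : ℂ) - ((γ⁻¹ • z₀ : ℍ) : ℂ)) :=
  rfl

/-- `r_1 = 0` (as it must be for an inhomogeneous cocycle). [folklore] -/
@[simp] theorem lewisZagierCocycle_one (s : ℂ) (z₀ : ℍ) (u : ℍ → ℂ) : lewisZagierCocycle s z₀ u 1 = 0 := by
  funext t
  simp [lewisZagierCocycle, greenPeriod]

/-- `r_{-γ} = r_γ`: the cocycle only sees the image of `γ` in `PGL₂(ℝ)`. [folklore] -/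
@[simp] theorem lewisZagierCocycle_neg (s : ℂ) (z₀ : ℍ) (u : ℍ → ℂ) (γ : GL (Fin 2) ℝ) :
    lewisZagierCocycle s z₀ u (-γ) = lewisZagierCocycle s z₀ u γ := by
  funext t
  simp only [lewisZagierCocycle]
  rw [show (-γ)⁻¹ = -γ⁻¹ from (neg_inv (a := γ)).symm, UpperHalfPlane.neg_smul]

end Cocycle

/-! ## 3. Invariant eigenfunctions and boundary orbits -/

section Invariant

/-- `u ∈ E_s^Γ`: a `Γ`-invariant `λ_s`-eigenfunction of the hyperbolic Laplacian
(`λ_s = s(1 - s)`; BLZ's `Δ = -y²(∂²_x + ∂²_y)`, so in the tree's sign convention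
`hypLaplacian u + s(1-s) u = 0`), of class `C²` (hence real-analytic, p. 9). For `Γ` with cusps,
`Maass_s(Γ)` and the cusp forms `Maass_s^0(Γ)` are subspaces of `E_s^Γ` (§10.1).
[cite: BruggemanLewisZagier2015, (1.1) p. 8 and §10.1 p. 65] -/
structure IsInvariantEigenfunction (Γ : Subgroup (GL (Fin 2) ℝ)) (s : ℂ) (u : ℍ → ℂ) : Prop where
  isC2 : IsC2 u
  eigen : ∀ z : ℍ, hypLaplacian u z + s * (1 - s) * u z = 0
  invariant : IsAutomorphic Γ u

/-- `0 ∈ E_s^Γ`. [folklore] -/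
theorem isInvariantEigenfunction_zero (Γ : Subgroup (GL (Fin 2) ℝ)) (s : ℂ) :
    IsInvariantEigenfunction Γ s (fun _ => 0) :=
  ⟨isC2_const 0, fun z => by simp, isAutomorphic_const Γ 0⟩

/-- "All `Γ`-orbits in `∂ℍ = P¹(ℝ)` are infinite" (BLZ p. 83), for the Möbius action of
`GL (Fin 2) ℝ` on `OnePoint ℝ` (Mathlib `OnePoint.instGLAction`). Holds for every cofinite
discrete `Γ` and, trivially, for every subgroup containing a translation `t ↦ t + h` and a map
`t ↦ t/(ht + 1)` with `h ≠ 0` (e.g. `Γ₁(N)`). [cite: BruggemanLewisZagier2015, §13.1 p. 83] -/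
def HasInfiniteBoundaryOrbits (Γ : Subgroup (GL (Fin 2) ℝ)) : Prop :=
  ∀ x : OnePoint ℝ, {y : OnePoint ℝ | ∃ γ ∈ Γ, γ • x = y}.Infinite

/-- A group with an infinite orbit is infinite. [folklore] -/
theorem HasInfiniteBoundaryOrbits.infinite {Γ : Subgroup (GL (Fin 2) ℝ)}
    (h : HasInfiniteBoundaryOrbits Γ) : (Γ : Set (GL (Fin 2) ℝ)).Infinite := by
  intro hfin
  apply h (OnePoint.infty : OnePoint ℝ)
  have : {y : OnePoint ℝ | ∃ γ ∈ Γ, γ • (OnePoint.infty : OnePoint ℝ) = y} =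
      (fun γ : GL (Fin 2) ℝ => γ • (OnePoint.infty : OnePoint ℝ)) '' (Γ : Set (GL (Fin 2) ℝ)) := by
    ext y; simp
  rw [this]
  exact hfin.image _

/-- Entries of the powers of an upper unipotent element `(1 h; 0 1)`. [folklore] -/
theorem gl_pow_apply_of_upper {γ : GL (Fin 2) ℝ} {h : ℝ}
    (h00 : (γ 0 0 : ℝ) = 1) (h01 : (γ 0 1 : ℝ) = h) (h10 : (γ 1 0 : ℝ) = 0) (h11 : (γ 1 1 : ℝ) = 1)
    (n : ℕ) :
    ((γ ^ n : GL (Fin 2) ℝ) 0 0 : ℝ) = 1 ∧ ((γ ^ n : GL (Fin 2) ℝ) 0 1 : ℝ) = n * h ∧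
      ((γ ^ n : GL (Fin 2) ℝ) 1 0 : ℝ) = 0 ∧ ((γ ^ n : GL (Fin 2) ℝ) 1 1 : ℝ) = 1 := by
  induction n with
  | zero =>
    refine ⟨?_, ?_, ?_, ?_⟩ <;> simp
  | succ n ih =>
    obtain ⟨a, b, c, d⟩ := ih
    refine ⟨?_, ?_, ?_, ?_⟩ <;>
      simp only [pow_succ, gl_mul_apply, a, b, c, d, h00, h01, h10, h11] <;> push_cast <;> ring

/-- Entries of the powers of a lower unipotent element `(1 0; h 1)`. [folklore] -/
theorem gl_pow_apply_of_lower {γ : GL (Fin 2) ℝ} {h : ℝ}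
    (h00 : (γ 0 0 : ℝ) = 1) (h01 : (γ 0 1 : ℝ) = 0) (h10 : (γ 1 0 : ℝ) = h) (h11 : (γ 1 1 : ℝ) = 1)
    (n : ℕ) :
    ((γ ^ n : GL (Fin 2) ℝ) 0 0 : ℝ) = 1 ∧ ((γ ^ n : GL (Fin 2) ℝ) 0 1 : ℝ) = 0 ∧
      ((γ ^ n : GL (Fin 2) ℝ) 1 0 : ℝ) = n * h ∧ ((γ ^ n : GL (Fin 2) ℝ) 1 1 : ℝ) = 1 := by
  induction n with
  | zero =>
    refine ⟨?_, ?_, ?_, ?_⟩ <;> simp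
  | succ n ih =>
    obtain ⟨a, b, c, d⟩ := ih
    refine ⟨?_, ?_, ?_, ?_⟩ <;>
      simp only [pow_succ, gl_mul_apply, a, b, c, d, h00, h01, h10, h11] <;> push_cast <;> ring

/-- **A cheap sufficient condition for infinite boundary orbits**: if `Γ` contains a translation
`(1 h; 0 1)` and a lower unipotent `(1 0; h' 1)` with `h, h' ≠ 0` (e.g. `Γ ⊇ Γ₁(N)`, `Γ(N)` with
`h = h' = N`), then every `Γ`-orbit in `P¹(ℝ)` is infinite: the orbit of `t ∈ ℝ` contains all
`t + n h`, and the orbit of `∞` contains all `1/(n h')`. [folklore] -/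
theorem hasInfiniteBoundaryOrbits_of_unipotents {Γ : Subgroup (GL (Fin 2) ℝ)} {h h' : ℝ}
    (hh : h ≠ 0) (hh' : h' ≠ 0)
    (hT : ∃ γ ∈ Γ, (γ 0 0 : ℝ) = 1 ∧ (γ 0 1 : ℝ) = h ∧ (γ 1 0 : ℝ) = 0 ∧ (γ 1 1 : ℝ) = 1)
    (hL : ∃ γ ∈ Γ, (γ 0 0 : ℝ) = 1 ∧ (γ 0 1 : ℝ) = 0 ∧ (γ 1 0 : ℝ) = h' ∧ (γ 1 1 : ℝ) = 1) :
    HasInfiniteBoundaryOrbits Γ := by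
  classical
  obtain ⟨T, hTΓ, t00, t01, t10, t11⟩ := hT
  obtain ⟨L, hLΓ, l00, l01, l10, l11⟩ := hL
  intro x
  induction x using OnePoint.rec with
  | infty =>
    -- the orbit of `∞` contains `L^(n+1) ∞ = 1 / ((n+1) h')`
    have hsub : Set.range (fun n : ℕ => (((1 : ℝ) / ((n + 1 : ℕ) * h') : ℝ) : OnePoint ℝ)) ⊆
        {y : OnePoint ℝ | ∃ γ ∈ Γ, γ • (OnePoint.infty : OnePoint ℝ) = y} := by
      rintro _ ⟨n, rfl⟩
      refine ⟨L ^ (n + 1), Γ.pow_mem hLΓ _, ?_⟩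
      obtain ⟨a, -, c, -⟩ := gl_pow_apply_of_lower l00 l01 l10 l11 (n + 1)
      have hc : ((L ^ (n + 1) : GL (Fin 2) ℝ) 1 0 : ℝ) ≠ 0 := by
        rw [c]; positivity
      rw [OnePoint.smul_infty_eq_ite, if_neg hc, a, c]
    refine Set.Infinite.mono hsub (Set.infinite_range_of_injective ?_)
    intro m n hmn
    have h1 : ((1 : ℝ) / ((m + 1 : ℕ) * h') : ℝ) = (1 : ℝ) / ((n + 1 : ℕ) * h') := by
      simpa using hmn
    have hm : ((m + 1 : ℕ) : ℝ) * h' ≠ 0 := by positivity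
    have hn : ((n + 1 : ℕ) : ℝ) * h' ≠ 0 := by positivity
    rw [div_eq_div_iff hm hn, one_mul, one_mul] at h1
    have h2 : ((n + 1 : ℕ) : ℝ) = ((m + 1 : ℕ) : ℝ) := mul_right_cancel₀ hh' h1
    have h3 : n + 1 = m + 1 := by exact_mod_cast h2
    omega
  | coe t =>
    -- the orbit of `t` contains `T^n t = t + n h`
    have hsub : Set.range (fun n : ℕ => ((t + n * h : ℝ) : OnePoint ℝ)) ⊆
        {y : OnePoint ℝ | ∃ γ ∈ Γ, γ • ((t : ℝ) : OnePoint ℝ) = y} := by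
      rintro _ ⟨n, rfl⟩
      refine ⟨T ^ n, Γ.pow_mem hTΓ _, ?_⟩
      obtain ⟨a, b, c, d⟩ := gl_pow_apply_of_upper t00 t01 t10 t11 n
      have hc : ¬ (((T ^ n : GL (Fin 2) ℝ) 1 0 : ℝ) * t + ((T ^ n : GL (Fin 2) ℝ) 1 1 : ℝ) = 0) := by
        rw [c, d]; simp
      rw [OnePoint.smul_some_eq_ite, if_neg hc, a, b, c, d]
      congr 1
      ring
    refine Set.Infinite.mono hsub (Set.infinite_range_of_injective ?_)
    intro m n hmn
    have h1 : (t + m * h : ℝ) = t + n * h := by simpa using hmn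
    have h2 : (m : ℝ) = n := by
      have := mul_right_cancel₀ hh (by linarith : (m : ℝ) * h = n * h)
      exact this
    exact_mod_cast h2

end Invariant

/-! ## 4. Named facts from Bruggeman–Lewis–Zagier -/

section Facts

/-- **BLZ, p. 29: "So `r_γ ∈ V_s^ω`."** For any subgroup `Γ ⊂ PSL₂(ℝ)`, `u ∈ E_s^Γ`
(`0 < Re s < 1`), base point `z₀ ∈ ℍ` and `γ ∈ Γ`, the period function
`r_γ = ∫_{γ⁻¹ z₀}^{z₀} [u, R(·; ·)^s]` is an analytic vector of the line model (real-analytic on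
`ℝ` with the convergent expansion (2.2) at `∞`). Named fact (the integrand is analytic in
`t ∈ P¹(ℝ)` for `z` on the compact segment). [cite: BruggemanLewisZagier2015, (5.5a) p. 29] -/
def BruggemanLewisZagier2015_cocycle_analytic : Prop :=
  ∀ (Γ : Subgroup (GL (Fin 2) ℝ)), Γ.HasDetOne →
    ∀ s : ℂ, 0 < s.re → s.re < 1 →
    ∀ u : ℍ → ℂ, IsInvariantEigenfunction Γ s u →
    ∀ z₀ : ℍ, ∀ γ ∈ Γ, IsAnalyticVector s (lewisZagierCocycle s z₀ u γ)

/-- **BLZ Proposition 5.1** (p. 30): "If the discrete subgroup `Γ ⊂ G` is infinite, then `r`,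
`p` and `q` are injective" — here `r : E_s^Γ → H¹(Γ; V_s^ω)`, `u ↦ [γ ↦ r_γ]` with
`r_γ = ∫_{γ⁻¹ z₀}^{z₀} [u, R(·;·)^s]` ((5.5a)), for every `s` with `0 < Re s < 1` (standing
assumption p. 8; the proof uses only `s ∉ ℤ`, so `s = 1/2` is included), and coboundaries are
`γ ↦ φ|(γ - 1) = φ|γ - φ`, `φ ∈ V_s^ω` ((5.4)). In the line model (identities off finite sets):
if `r^u` is the coboundary of an analytic vector then `u = 0`. (`p`, `q` are isomorphic images of
`r` under the Poisson and transverse Poisson transforms and are not vendored.)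
[cite: BruggemanLewisZagier2015, Proposition 5.1 p. 30] -/
def BruggemanLewisZagier2015_prop_5_1 : Prop :=
  ∀ (Γ : Subgroup (GL (Fin 2) ℝ)), Γ.HasDetOne → DiscreteTopology Γ →
    (Γ : Set (GL (Fin 2) ℝ)).Infinite →
    ∀ s : ℂ, 0 < s.re → s.re < 1 →
    ∀ u : ℍ → ℂ, IsInvariantEigenfunction Γ s u →
    ∀ z₀ : ℍ,
      (∃ φ : ℝ → ℂ, IsAnalyticVector s φ ∧
        ∀ γ ∈ Γ, ∀ᶠ t in cofinite, lewisZagierCocycle s z₀ u γ t = lineSlash s γ φ t - φ t) →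
      ∀ z : ℍ, u z = 0

/-- **BLZ §13.1, p. 83: `S_s^Γ = {0}`.** For the space of singularities `S_s = V_s^{ω*}/V_s^ω`:
"Since all `Γ`-orbits in `∂ℍ` are infinite, we have `(W/V_s^ω)^Γ ⊂ S_s^Γ = {0}`" (for every
`ℚ[Γ]`-module `V_s^ω ⊂ W ⊂ V_s^{ω*}`; whence `H¹_par(Γ; V_s^ω, W) → H¹_par(Γ; W)` is injective,
(13.2)). In the line model: a semi-analytic vector `φ` such that every `φ|γ - φ` (`γ ∈ Γ`) agrees
off a finite set with an analytic vector, agrees off a finite set with an analytic vector. (The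
printed reason: the finite set of singularities `BdSing φ ⊂ P¹(ℝ)` is `Γ`-invariant, hence empty.)
[cite: BruggemanLewisZagier2015, §13.1 (13.2) p. 83] -/
def BruggemanLewisZagier2015_singularities_invariants : Prop :=
  ∀ (Γ : Subgroup (GL (Fin 2) ℝ)), Γ.HasDetOne → HasInfiniteBoundaryOrbits Γ →
    ∀ s : ℂ, 0 < s.re → s.re < 1 →
    ∀ φ : ℝ → ℂ, IsSemiAnalyticVector φ →
      (∀ γ ∈ Γ, ∃ ψ : ℝ → ℂ, IsAnalyticVector s ψ ∧
        ∀ᶠ t in cofinite, lineSlash s γ φ t - φ t = ψ t) →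
      ∃ φ' : ℝ → ℂ, IsAnalyticVector s φ' ∧ ∀ᶠ t in cofinite, φ t = φ' t

end Facts

/-! ## 5. Consequence: period classes of invariant eigenfunctions are non-trivial in
`H¹(Γ; V_s^{ω*})` -/

section Consequence

/-- **Injectivity of `E_s^Γ → H¹(Γ; V_s^{ω*})`** (the form used by route
`Langlands/RationalPeriodQuarter`, crux `PeriodClassNontrivialQuarter`, at `s = 1/2`,
`Γ = Γ₁(N)`): for `Γ ≤ GL₂(ℝ)` of determinant one, discrete, all of whose orbits in `P¹(ℝ)` are
infinite, and `u ∈ E_s^Γ` (`0 < Re s < 1`), if the period cocycle `r^u` (any base point) is,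
off finite sets, the coboundary `φ|γ - φ` of a **semi-analytic** vector `φ`, then `u = 0`.
Proof: `φ|γ - φ ≡ r_γ ∈ V_s^ω` (p. 29), so `φ ≡ φ' ∈ V_s^ω` by `S_s^Γ = 0` (p. 83), and then
Proposition 5.1 applies. [cite: BruggemanLewisZagier2015, Proposition 5.1 p. 30 and §13.1 p. 83] -/
theorem eq_zero_of_lewisZagierCocycle_semiAnalytic_coboundary
    (hB : BruggemanLewisZagier2015_cocycle_analytic) (hA : BruggemanLewisZagier2015_prop_5_1)
    (hC : BruggemanLewisZagier2015_singularities_invariants)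
    {Γ : Subgroup (GL (Fin 2) ℝ)} (hdet : Γ.HasDetOne) (hdisc : DiscreteTopology Γ)
    (horb : HasInfiniteBoundaryOrbits Γ) {s : ℂ} (hs₀ : 0 < s.re) (hs₁ : s.re < 1)
    {u : ℍ → ℂ} (hu : IsInvariantEigenfunction Γ s u) (z₀ : ℍ)
    (h : ∃ φ : ℝ → ℂ, IsSemiAnalyticVector φ ∧
      ∀ γ ∈ Γ, ∀ᶠ t in cofinite, lewisZagierCocycle s z₀ u γ t = lineSlash s γ φ t - φ t) :
    ∀ z : ℍ, u z = 0 := by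
  obtain ⟨φ, hφ, hcob⟩ := h
  -- Step 1 (p. 83): `φ` is an analytic vector up to a finite set.
  obtain ⟨φ', hφ', hφφ'⟩ := hC Γ hdet horb s hs₀ hs₁ φ hφ (fun γ hγ =>
    ⟨lewisZagierCocycle s z₀ u γ, hB Γ hdet s hs₀ hs₁ u hu z₀ γ hγ,
      (hcob γ hγ).mono fun t ht => ht.symm⟩)
  -- Step 2 (Prop. 5.1): `r^u` is then the coboundary of the analytic vector `φ'`.
  refine hA Γ hdet hdisc horb.infinite s hs₀ hs₁ u hu z₀ ⟨φ', hφ', fun γ hγ => ?_⟩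
  filter_upwards [hcob γ hγ, lineSlash_congr_cofinite s γ hφφ', hφφ'] with t h1 h2 h3
  rw [h1, h2, h3]

end Consequence

end Literature.NumberTheory.Automorphic
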